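import Summits.ResolutionOfSingularities.ResolutionOfSingularities.Theorems.HilbertSamuelEliminationSigmaMaxModificationsCorridor3SigmaBoundaryCompactness
import HarnessLib

/-!
# [OURS · L1 W4.2] σE-COMPACTNESS, part 3: the RUN-WISE E-SCOPE, the termination dichotomy for boundary-aware strategies, good initial states
# from admissibility, and the headline «no infinite σE-near chain from any closed point of `Y(ν)` ⇒ the admissible functional σ-run
# TERMINATES ⇒ a `ν`-elimination ⇒ the line's `ν`-modification»
# (cell res-hironaka, LADDER-RESOLUTION rung L; slot W4.2, crux chain w42 `SigmaMaxModificationsCorridor3` stmt-ResolutionOfSingularities-19249 /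
# crux stmt-…-18506; res-L1-w42-plan-1 RULING v3.14-13 (CW) «(E5) σE-COMPACTNESS» (α) headline + (β) glue; hand res-D-pv-047 AS
# res-L1-s46-pv-10; `--supports stmt-ResolutionOfSingularities-19249 --as helper`)

HONEST FRAMING. OURS proof architecture over parts 1/2a/1c/1d-defs (p519751, p520618, p521892, p523041, p523856) and σE-compactness parts 1–2
(p525937, `…Corridor3SigmaBoundaryCompactness.lean`); NOTHING is a statement of H. Hironaka's manuscript [Hironaka2017] nor of
Cossart–Jannsen–Saito; no named fact is introduced — CJS Thm. 3.10 (1) enters through the tree's PROVED theorems only. AI-written; AI review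
is weaker than expert review.

## Contents (namespace `…Theorems.SigmaMaxModificationsCorridor3.Sigma`)

* §1 `StrategyE.RunReachableState p σ N ν E₀` — the RUN-WISE boundary-threaded scope (states reached by boundary-threaded σ-steps on
  point-free states from the initial state of a maximal origin of characteristic `p`, started with the boundary `E₀ X x`), its
  propagation, and the export `StrategyE.reachableState_subset_runReachableState` (o1's marked scope ⊆ the run-wise one).
* §2 TOTALITY ⇒ PROLONGATION ⇒ DICHOTOMY for `σ : StrategyE` admissible on the run-wise scope (o1's `IsAdmissibleStrategyOnE`):
  `exists_isRunFromσE_succ`, **`runTerminatesσE_or_runInfiniteσE`**.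
* §3 A terminating admissible σE-run is a `ν`-ELIMINATION (`IsRunFromσE.isNuElimination`, `exists_isNuElimination_of_runTerminatesσE`) and
  admissibility along runs gives the «permissible runs» clause of a good state: **`stateGoodσE_init`** (the good INITIAL state of a
  maximal-origin datum for an admissible σ — finite type over `k`, `dim ≤ N`, `ν` maximal hence never exceeded, permissible runs).
* §4 THE HEADLINE **`runTerminatesσE_of_forall_noInfiniteNearChainσE`**: σ functional + stepping only while the stratum is non-empty +
  admissible on the run-wise scope, `(Y, ν)` a maximal-origin datum, and NO closed point `y ∈ Y(ν)` starting an infinite σE-near chain ⇒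
  the σE-run from `Y` TERMINATES; with §3 **`exists_isNuElimination_of_forall_noInfiniteNearChainσE`** and the packaging
  **`nuMod_of_forall_noInfiniteNearChainσE : … → TameWild.NuMod Y 3 d ν`** (through the tree's `TameWild.nuMod_of_isNuElimination`).

## Not here

(γ) the Ω⁺E variants (after res-type-040's Ω⁺E lands); the converse scope inclusion RunReachable ⊆ Reachable (backward closed marked points).

## References (context)

* V. Cossart, U. Jannsen, S. Saito, LNM 2270 (2020), Rem. 6.29 (1), Def. 6.14, Thm. 3.10 (1). [CossartJannsenSaito2020]
-/

noncomputable section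

set_option linter.dupNamespace false -- mandated namespace of this single-conjunct summit

open CategoryTheory AlgebraicGeometry TopologicalSpace Topology
open Summit.ResolutionOfSingularities.ResolutionOfSingularities.Theorems.CampaignW42
open Literature.AlgebraicGeometry.Resolution Literature.RingTheory.HilbertSamuel
open Literature.AlgebraicGeometry.CossartJannsenSaito2020

namespace Summit.ResolutionOfSingularities.ResolutionOfSingularities.Theorems.SigmaMaxModificationsCorridor3.Sigma

universe u

variable {σ : StrategyE.{u}} {N : ℕ} {ν : ℕ → ℕ}

/-! ## §1. The run-wise boundary-threaded scope -/

/-- [OURS · L1 W4.2] **The RUN-WISE boundary-threaded scope**: the state `(W, L, P, E)` is reached by boundary-threaded σ-steps on point-free states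
(`StateReachesσE`, p523856) from the initial state of a MAXIMAL ORIGIN of characteristic `p` started with the boundary `E₀ X x`. [folklore] -/
def StrategyE.RunReachableState (p : ℕ) (σ : StrategyE.{u}) (N : ℕ) (ν : ℕ → ℕ) (E₀ : ∀ (X : Scheme.{u}), X → Boundary X) :
    ∀ (W : Scheme.{u}), IsLocallyNoetherian W → Labelling W → Option (Pending W) → Boundary W → Prop :=
  fun W hW L P E => ∃ (X : Scheme.{u}) (hX : IsLocallyNoetherian X) (x : X),
    IsMaximalOrigin p N ν X x ∧ StateReachesσE σ N ν (StateσE.init X hX (E₀ X x)) ⟨⟨W, hW, L, P⟩, E⟩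

/-- The initial state of a maximal origin is run-reachable. [folklore] -/
theorem StrategyE.runReachableState_init {p : ℕ} {E₀ : ∀ (X : Scheme.{u}), X → Boundary X} {X : Scheme.{u}}
    [hX : IsLocallyNoetherian X] {x : X} (hx : IsMaximalOrigin p N ν X x) :
    StrategyE.RunReachableState p σ N ν E₀ X hX (Labelling.init X) none (E₀ X x) :=
  ⟨X, hX, x, hx, Relation.ReflTransGen.refl⟩

/-- Run-reachable states are stable under σ-steps (boundary threaded by `E.next C`). [folklore] -/
theorem StrategyE.RunReachableState.step {p : ℕ} {E₀ : ∀ (X : Scheme.{u}), X → Boundary X} {W : Scheme.{u}}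
    {hW : IsLocallyNoetherian W} {L : Labelling W} {P : Option (Pending W)} {E : Boundary W}
    (h : StrategyE.RunReachableState p σ N ν E₀ W hW L P E) {C : W.IdealSheafData} {P' : Option (Pending (blowup C))}
    (hstep : σ.step W hW N ν L P E C P') (h' : IsLocallyNoetherian (blowup C)) :
    StrategyE.RunReachableState p σ N ν E₀ (blowup C) h' (L.next (Scheme.hsStratum W N ν) C) P' (E.next C) := by
  obtain ⟨X, hX, x, hx, hreach⟩ := h
  exact ⟨X, hX, x, hx, hreach.tail ⟨C, P', h', hstep, rfl⟩⟩

/-- **o1's marked scope ⊆ the run-wise scope** (forget the marked points): `StrategyE.ReachableState p σ N ν E₀ ⊆ StrategyE.RunReachableState p σ N ν E₀`.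
[folklore] -/
theorem StrategyE.reachableState_subset_runReachableState {p : ℕ} {E₀ : ∀ (X : Scheme.{u}), X → Boundary X} {W : Scheme.{u}}
    {hW : IsLocallyNoetherian W} {L : Labelling W} {P : Option (Pending W)} {E : Boundary W}
    (h : StrategyE.ReachableState p σ N ν E₀ W hW L P E) : StrategyE.RunReachableState p σ N ν E₀ W hW L P E := by
  obtain ⟨x, X, hX, x₀, hx₀, hreach⟩ := h
  exact ⟨X, hX, x₀, hx₀, hreach.stateReachesσE⟩

/-- Admissibility on the run-wise scope gives admissibility on o1's marked scope. [folklore] -/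
theorem IsAdmissibleStrategyOnE.of_runReachableState {p : ℕ} {E₀ : ∀ (X : Scheme.{u}), X → Boundary X}
    (h : IsAdmissibleStrategyOnE (StrategyE.RunReachableState p σ N ν E₀) N ν σ) :
    IsAdmissibleStrategyOnE (StrategyE.ReachableState p σ N ν E₀) N ν σ :=
  fun W hW L P E hS => h W hW L P E (StrategyE.reachableState_subset_runReachableState hS)

/-! ## §2. Totality on the run-wise scope: prolongation and the termination dichotomy -/

/-- **EVERY σE-RUN FROM A RUN-REACHABLE STATE WITH NON-EMPTY LAST `ν`-STRATUM IS PROLONGED** when σ is admissible (total) on the run-wise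
scope. [folklore] -/
theorem exists_isRunFromσE_succ {p : ℕ} {E₀ : ∀ (X : Scheme.{u}), X → Boundary X}
    (hadm : IsAdmissibleStrategyOnE (StrategyE.RunReachableState p σ N ν E₀) N ν σ) :
    ∀ {W : Scheme.{u}} (hW : IsLocallyNoetherian W) (L : Labelling W) (P : Option (Pending W)) (E : Boundary W),
      StrategyE.RunReachableState p σ N ν E₀ W hW L P E →
        ∀ (s : CentreSeq W), IsRunFromσE σ N ν hW L P E s → (Scheme.hsStratum s.top N ν).Nonempty →
          ∃ s' : CentreSeq W, IsRunFromσE σ N ν hW L P E s' ∧ s'.length = s.length + 1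
  | W, hW, L, P, E, hr, CentreSeq.nil _, _, hY => by
    obtain ⟨C, P', hst⟩ := (hadm W hW L P E hr).2 hY
    exact ⟨CentreSeq.cons C (CentreSeq.nil _), ⟨P', hst, trivial⟩, rfl⟩
  | W, hW, L, P, E, hr, CentreSeq.cons C rest, hs, hY => by
    obtain ⟨P', hst, hrest⟩ := hs
    obtain ⟨rest', hrest', hlen⟩ :=
      exists_isRunFromσE_succ hadm _ _ P' (E.next C) (hr.step hst _) rest hrest hY
    exact ⟨CentreSeq.cons C rest', ⟨P', hst, hrest'⟩, by simp [hlen]⟩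

/-- **THE TERMINATION DICHOTOMY for boundary-aware strategies**: σ admissible on the run-wise scope, `(X, x)` a maximal origin ⇒ the σE-run
from `X` (boundary `E₀ X x`) terminates or goes on for ever. [folklore] -/
theorem runTerminatesσE_or_runInfiniteσE {p : ℕ} {E₀ : ∀ (X : Scheme.{u}), X → Boundary X}
    (hadm : IsAdmissibleStrategyOnE (StrategyE.RunReachableState p σ N ν E₀) N ν σ)
    {X : Scheme.{u}} [hX : IsLocallyNoetherian X] {x : X} (hx : IsMaximalOrigin p N ν X x) :
    RunTerminatesσE σ N ν X (E₀ X x) ∨ RunInfiniteσE σ N ν X (E₀ X x) := by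
  classical
  by_cases hinf : RunInfiniteσE σ N ν X (E₀ X x)
  · exact Or.inr hinf
  left
  have hex : ∃ n, ¬ ∃ s : CentreSeq X, IsRunσE σ N ν (E₀ X x) s ∧ s.length = n := not_forall.mp hinf
  have hn₀ : ¬ ∃ s : CentreSeq X, IsRunσE σ N ν (E₀ X x) s ∧ s.length = Nat.find hex := Nat.find_spec hex
  have hpos : Nat.find hex ≠ 0 := by
    intro h0
    exact hn₀ ⟨CentreSeq.nil X, trivial, by rw [h0]; rfl⟩
  obtain ⟨m, hm⟩ := Nat.exists_eq_succ_of_ne_zero hpos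
  have hm' : ∃ s : CentreSeq X, IsRunσE σ N ν (E₀ X x) s ∧ s.length = m :=
    not_not.mp (Nat.find_min hex (show m < Nat.find hex by omega))
  obtain ⟨s, hs, hlen⟩ := hm'
  by_cases hY : (Scheme.hsStratum s.top N ν).Nonempty
  · obtain ⟨s', hs', hlen'⟩ :=
      exists_isRunFromσE_succ hadm hX _ _ _ (StrategyE.runReachableState_init hx) s hs hY
    exact absurd ⟨s', hs', by rw [hlen', hlen, hm]⟩ hn₀
  · exact ⟨s, hs, Set.not_nonempty_iff_eq_empty.mp hY⟩

/-! ## §3. ν-eliminations from terminating runs; the good initial state of an admissible σ -/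

/-- **AN ADMISSIBLE σE-RUN ENDING WITH AN EMPTY `ν`-STRATUM IS A `ν`-ELIMINATION** (CJS Def. 6.14).
[cite: CossartJannsenSaito2020, Def. 6.14] -/
theorem IsRunFromσE.isNuElimination {p : ℕ} {E₀ : ∀ (X : Scheme.{u}), X → Boundary X}
    (hadm : IsAdmissibleStrategyOnE (StrategyE.RunReachableState p σ N ν E₀) N ν σ) :
    ∀ {W : Scheme.{u}} (hW : IsLocallyNoetherian W) (L : Labelling W) (P : Option (Pending W)) (E : Boundary W),
      StrategyE.RunReachableState p σ N ν E₀ W hW L P E →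
        ∀ (s : CentreSeq W), IsRunFromσE σ N ν hW L P E s → Scheme.hsStratum s.top N ν = ∅ → s.IsNuElimination N ν
  | W, hW, L, P, E, _, CentreSeq.nil _, _, hY => ⟨trivial, trivial, hY⟩
  | W, hW, L, P, E, hr, CentreSeq.cons C rest, hs, hY => by
    obtain ⟨P', hst, hrest⟩ := hs
    obtain ⟨hperm, hsub, -⟩ := (hadm W hW L P E hr).1 C P' hst
    obtain ⟨hperm', hstr', htop'⟩ := IsRunFromσE.isNuElimination hadm _ _ P' (E.next C) (hr.step hst _) rest hrest hY
    exact ⟨⟨hperm, hperm'⟩, ⟨hsub, hstr'⟩, htop'⟩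

/-- **A TERMINATING σE-RUN FROM A MAXIMAL ORIGIN YIELDS A `ν`-ELIMINATION.** [cite: CossartJannsenSaito2020, Def. 6.14] -/
theorem exists_isNuElimination_of_runTerminatesσE {p : ℕ} {E₀ : ∀ (X : Scheme.{u}), X → Boundary X}
    (hadm : IsAdmissibleStrategyOnE (StrategyE.RunReachableState p σ N ν E₀) N ν σ)
    {X : Scheme.{u}} [hX : IsLocallyNoetherian X] {x : X} (hx : IsMaximalOrigin p N ν X x)
    (h : RunTerminatesσE σ N ν X (E₀ X x)) : ∃ s : CentreSeq X, s.IsNuElimination N ν := by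
  obtain ⟨s, hs, hY⟩ := h
  exact ⟨s, IsRunFromσE.isNuElimination hadm hX _ _ _ (StrategyE.runReachableState_init hx) s hs hY⟩

/-- Admissibility along run-reachable states gives PERMISSIBLE RUNS (the `permRuns` clause of a good state). [folklore] -/
theorem allPermissible_of_isRunFromσE {p : ℕ} {E₀ : ∀ (X : Scheme.{u}), X → Boundary X}
    (hadm : IsAdmissibleStrategyOnE (StrategyE.RunReachableState p σ N ν E₀) N ν σ) :
    ∀ {W : Scheme.{u}} (hW : IsLocallyNoetherian W) (L : Labelling W) (P : Option (Pending W)) (E : Boundary W),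
      StrategyE.RunReachableState p σ N ν E₀ W hW L P E →
        ∀ (t : CentreSeq W), IsRunFromσE σ N ν hW L P E t → t.AllPermissible
  | W, hW, L, P, E, _, CentreSeq.nil _, _ => trivial
  | W, hW, L, P, E, hr, CentreSeq.cons C rest, ht => by
    obtain ⟨P', hst, hrest⟩ := ht
    exact ⟨((hadm W hW L P E hr).1 C P' hst).1,
      allPermissible_of_isRunFromσE hadm _ _ P' (E.next C) (hr.step hst _) rest hrest⟩

/-- **THE GOOD INITIAL STATE of a maximal-origin datum for an admissible σ**: `X` reduced, separated, of finite type over a field `k` of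
characteristic `p`, `dim X ≤ N`, `ν` a MAXIMAL value (hence never exceeded), and permissible σE-runs from the initial state (admissibility on the
run-wise scope). [folklore] -/
theorem exists_stateGoodσE_init {p : ℕ} {E₀ : ∀ (X : Scheme.{u}), X → Boundary X}
    (hadm : IsAdmissibleStrategyOnE (StrategyE.RunReachableState p σ N ν E₀) N ν σ)
    {X : Scheme.{u}} [hX : IsLocallyNoetherian X] {x : X} (hx : IsMaximalOrigin p N ν X x) :
    ∃ (k : Type u) (_ : Field k), StateGoodσE k σ N ν X hX (Labelling.init X) none (E₀ X x) := by
  obtain ⟨k, hk, _, f, -, hft, hqc⟩ := hx.exists_structure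
  refine ⟨k, hk, ⟨f, hft, hqc⟩, hx.dim_le, fun w hw => le_antisymm (hx.maximal.2 ⟨w, rfl⟩ hw) hw, fun t ht => ?_⟩
  exact allPermissible_of_isRunFromσE hadm hX _ _ _ (StrategyE.runReachableState_init hx) t ht

/-! ## §4. The headline: no infinite σE-near chain from any closed point of `Y(ν)` ⇒ termination ⇒ `ν`-elimination ⇒ `ν`-modification -/

/-- **(CW) HEADLINE — NO INFINITE σE-NEAR CHAIN FROM ANY CLOSED POINT OF `X(ν)` ⇒ THE σE-RUN TERMINATES** (σ functional, stepping only while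
the stratum is non-empty, admissible on the run-wise scope; `(X, x)` a maximal origin of characteristic `p`).
[cite: CossartJannsenSaito2020, Rem. 6.29 (1), p. 107] -/
theorem runTerminatesσE_of_forall_noInfiniteNearChainσE {p : ℕ} {E₀ : ∀ (X : Scheme.{u}), X → Boundary X}
    (hσ : σ.IsFunctional N ν) (hne : σ.StepsOnlyWhileNonempty N ν)
    (hadm : IsAdmissibleStrategyOnE (StrategyE.RunReachableState p σ N ν E₀) N ν σ)
    {X : Scheme.{u}} [hX : IsLocallyNoetherian X] {x : X} (hx : IsMaximalOrigin p N ν X x)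
    (hno : ∀ y : X, y ∈ Scheme.hsStratum X N ν → IsClosed ({y} : Set X) →
      ¬ ∃ c : ℕ → MarkedStageE.{u}, c 0 = MarkedStageE.init X y (E₀ X x) ∧ ∀ n, CanonicalNearStepσE σ N ν (c n) (c (n + 1))) :
    RunTerminatesσE σ N ν X (E₀ X x) := by
  obtain ⟨k, hk, hgood⟩ := exists_stateGoodσE_init hadm hx
  rcases runTerminatesσE_or_runInfiniteσE hadm hx with h | h
  · exact h
  · exact absurd h (not_runInfiniteσE_of_forall_noNearChainσE hσ hne (E₀ X x) hgood hno)

/-- **… ⇒ A `ν`-ELIMINATION OF `X` EXISTS.** [cite: CossartJannsenSaito2020, Def. 6.14] -/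
theorem exists_isNuElimination_of_forall_noInfiniteNearChainσE {p : ℕ} {E₀ : ∀ (X : Scheme.{u}), X → Boundary X}
    (hσ : σ.IsFunctional N ν) (hne : σ.StepsOnlyWhileNonempty N ν)
    (hadm : IsAdmissibleStrategyOnE (StrategyE.RunReachableState p σ N ν E₀) N ν σ)
    {X : Scheme.{u}} [hX : IsLocallyNoetherian X] {x : X} (hx : IsMaximalOrigin p N ν X x)
    (hno : ∀ y : X, y ∈ Scheme.hsStratum X N ν → IsClosed ({y} : Set X) →
      ¬ ∃ c : ℕ → MarkedStageE.{u}, c 0 = MarkedStageE.init X y (E₀ X x) ∧ ∀ n, CanonicalNearStepσE σ N ν (c n) (c (n + 1))) :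
    ∃ s : CentreSeq X, s.IsNuElimination N ν :=
  exists_isNuElimination_of_runTerminatesσE hadm hx (runTerminatesσE_of_forall_noInfiniteNearChainσE hσ hne hadm hx hno)

/-- **… ⇒ THE LINE'S `ν`-MODIFICATION** `TameWild.NuMod Y 3 d ν` (`d ≥ dim Y`) at level `3`, through the tree's unconditional
`TameWild.nuMod_of_isNuElimination` (CJS Thm. 3.10 (1) proved in the tree). [cite: CossartJannsenSaito2020, Def. 6.14, Thm. 3.10 (1)] -/
theorem nuMod_of_forall_noInfiniteNearChainσE {p : ℕ} {σ : StrategyE.{0}} {ν : ℕ → ℕ} {E₀ : ∀ (X : Scheme.{0}), X → Boundary X}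
    (hσ : σ.IsFunctional 3 ν) (hne : σ.StepsOnlyWhileNonempty 3 ν)
    (hadm : IsAdmissibleStrategyOnE (StrategyE.RunReachableState p σ 3 ν E₀) 3 ν σ)
    {Y : Scheme.{0}} [hY : IsLocallyNoetherian Y] {y : Y} (hy : IsMaximalOrigin p 3 ν Y y) {d : ℕ}
    (hd : topologicalKrullDim Y ≤ (d : WithBot ℕ∞))
    (hno : ∀ y' : Y, y' ∈ Scheme.hsStratum Y 3 ν → IsClosed ({y'} : Set Y) →
      ¬ ∃ c : ℕ → MarkedStageE.{0}, c 0 = MarkedStageE.init Y y' (E₀ Y y) ∧ ∀ n, CanonicalNearStepσE σ 3 ν (c n) (c (n + 1))) :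
    TameWild.NuMod Y 3 d ν := by
  obtain ⟨s, hs⟩ := exists_isNuElimination_of_forall_noInfiniteNearChainσE hσ hne hadm hy hno
  obtain ⟨k, _, _, g, -, hft, -⟩ := hy.exists_structure
  haveI := hft
  haveI := hy.isReduced
  exact TameWild.nuMod_of_isNuElimination g hd hy.dim_le hy.maximal s hs

end Summit.ResolutionOfSingularities.ResolutionOfSingularities.Theorems.SigmaMaxModificationsCorridor3.Sigma

end
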